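import Summits.Ventures.HSemireg.WedgeHankelRecurrenceGaussLobattoGolub

/-!
# Venture HSemireg — **A FAVARD RULE SEES ONLY THE LEADING JACOBI BLOCK**: if two positive recurrences have `q'_k = q_k` for `k ≤ n + 1` (equivalently share `a_0, …, a_n` and `b_1, …, b_n`),
# then ANY Favard rule of `q` (level `T ≥ n`) and ANY Favard rule of `q'` (level `T' ≥ n`) agree on every polynomial of degree `≤ 2n + 1`: `Σ μ f(x) = Σ μ' f(y)` — the common principle
# behind N286 (nested levels of one recurrence), N366 (anti-Gauss), N367 ∕ N368 (Golub's Radau ∕ Lobatto): the degree of exactness is read off the length of the shared prefix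

HONEST FRAMING. Part of the Lean index of the computation cell `pub-hsemireg` (seat p10 gen 45, Sunday typer «UNIFORM-IN-n»).  Real polynomials and finite sums only (`Polynomial.modByMonic`); no
variety, no cohomology theory, no sheaf, no Ext group and no semiregularity map is constructed here; nothing here says that HC / HC_CM / HC_AV holds; no Literature fact (unproved `Prop`) is declared
or used.  Custodian versions as in `WedgeHankelSiegelIdeal` (1/3).
SOURCES (cited).  W. Gautschi, *Orthogonal Polynomials: Computation and Approximation* (2004) Thm 1.45 ∕ §3.1 (a rule with the nodes of `π_N` orthogonal to degree `k − 1` has degree of exactness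
`N − 1 + k`); G. H. Golub, SIAM Rev. 15 (1973) §§5–7; D. P. Laurie, Math. Comp. 65 (1996) §2 (the functional is determined in degree `≤ 2n+1` by the leading `(n+1) × (n+1)` block).
PROOF TYPED HERE.  `f = q_{n+1} G + R` (`deg G, deg R ≤ n`); `Σ μ (q_{n+1} G)(x) = 0` (pairing orthogonality at level `T ≥ n + 1`, or `q_{T+1}(x_k) = 0` when `T = n`), likewise for `q'`; and
`Σ μ R(x) = Σ μ' R(y)` because both functionals take the value `[d = 0]` on `q_d`, `d ≤ n` (N366 `functional_vanish_of_monic_family`).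
DEDUP DISCLOSURE (`rg -n 'levels_agree|prefix' Summits/Ventures/HSemireg`, 2026-09-03): N286 `favard_levels_agree` is the case `q' = q`; the two-recurrence form is new and is what N366–N368
specialise.  The 3 names below: 0 hits tree-wide.

WHAT IS IN THE TREE.  N366 `functional_vanish_of_monic_family`, `sum_mul_eval_mul_add`, `sum_mul_eval_mul_smul`; N279 `recurrence_monic_natDegree`; N286 `favard_levels_agree`.
THIS FILE (namespace `Summit.Ventures.HSemireg.Wedge.HankelOuter` continued; CHAINED on N368 (import only); 0 definitions):
* §1134 `favard_rule_orthogonal_succ` (`Σ μ (q_{n+1} G)(x) = 0` for `deg G ≤ n` under a level-`T` pairing, `n ≤ T`), `favard_rule_low_agree` (two rules of prefix-sharing recurrences agree in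
  degree `≤ n`), **`favard_prefix_exact`** (they agree in degree `≤ 2n + 1`).
CAVEATS.  Pairing hypotheses as produced by N323 `favard_pairing_at_zeros`; the zeros enter only through `q_{T+1}(x_k) = 0`.  Nothing Ext-side.  New names only.
-/

open Module Polynomial
open scoped Matrix Polynomial

namespace Summit.Ventures.HSemireg.Wedge.HankelOuter

/-! ## §1134. Exactness from the shared Jacobi prefix -/

/-- **`Σ_k μ_k (q_{n+1} G)(x_k) = 0` for `deg G ≤ n`** when `(μ, x)` carries the level-`T` Favard pairing of `q` on the zeros of `q_{T+1}` and `n ≤ T`. [this file, §1134] -/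
theorem favard_rule_orthogonal_succ {q : ℕ → ℝ[X]} {a b : ℕ → ℝ} (hq0 : q 0 = 1) (hq1 : q 1 = Polynomial.X - C (a 0))
    (hrec : ∀ n, q (n + 2) = (Polynomial.X - C (a (n + 1))) * q (n + 1) - C (b (n + 1)) * q n)
    {T n : ℕ} (hn : n ≤ T) {μ x : Fin (T + 1) → ℝ} (hxr : ∀ k, (q (T + 1)).eval (x k) = 0)
    (hpair : ∀ i j : Fin (T + 1), ∑ k, μ k * ((q i).eval (x k) * (q j).eval (x k)) = if i = j then ∏ l ∈ Finset.Ico 1 ((j : ℕ) + 1), b l else 0)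
    {G : ℝ[X]} (hG : G.natDegree ≤ n) : ∑ k, μ k * (q (n + 1) * G).eval (x k) = 0 := by
  refine functional_vanish_of_monic_family (Φ := fun F => ∑ k, μ k * (q (n + 1) * F).eval (x k))
    (fun F G => by simp only [sum_mul_eval_mul_add]) (fun c F => by simp only [sum_mul_eval_mul_smul])
    (fun d hd => (recurrence_monic_natDegree hq0 hq1 hrec d).1) (fun d hd => (recurrence_monic_natDegree hq0 hq1 hrec d).2) (fun d hd => ?_) hG
  rcases Nat.lt_or_ge n T with hnT | hnT
  · have h := hpair ⟨n + 1, by omega⟩ ⟨d, by omega⟩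
    rw [if_neg (fun h' => by have := Fin.mk.inj_iff.1 h'; omega)] at h
    simpa only [eval_mul] using h
  · have hnT' : n = T := le_antisymm hn hnT
    subst hnT'
    exact Finset.sum_eq_zero fun k _ => by rw [eval_mul, hxr k, zero_mul, mul_zero]

/-- **Two Favard rules of prefix-sharing recurrences agree in degree `≤ n`** (`q'_k = q_k` for `k ≤ n`; both functionals take the value `[d = 0]` on `q_d`). [this file, §1134] -/
theorem favard_rule_low_agree {q q' : ℕ → ℝ[X]} {a b b' : ℕ → ℝ} (hq0 : q 0 = 1) (hq1 : q 1 = Polynomial.X - C (a 0))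
    (hrec : ∀ n, q (n + 2) = (Polynomial.X - C (a (n + 1))) * q (n + 1) - C (b (n + 1)) * q n)
    {T T' n : ℕ} (hn : n ≤ T) (hn' : n ≤ T') (hshare : ∀ k, k ≤ n → q' k = q k)
    {μ x : Fin (T + 1) → ℝ} {μ' y : Fin (T' + 1) → ℝ}
    (hpair : ∀ i j : Fin (T + 1), ∑ k, μ k * ((q i).eval (x k) * (q j).eval (x k)) = if i = j then ∏ l ∈ Finset.Ico 1 ((j : ℕ) + 1), b l else 0)
    (hpair' : ∀ i j : Fin (T' + 1), ∑ k, μ' k * ((q' i).eval (y k) * (q' j).eval (y k)) = if i = j then ∏ l ∈ Finset.Ico 1 ((j : ℕ) + 1), b' l else 0)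
    {R : ℝ[X]} (hR : R.natDegree ≤ n) : ∑ k, μ k * R.eval (x k) = ∑ k, μ' k * R.eval (y k) := by
  have h := functional_vanish_of_monic_family (Φ := fun F => ∑ k, μ k * F.eval (x k) - ∑ k, μ' k * F.eval (y k))
    (fun F G => by
      have h1 := sum_mul_eval_mul_add μ x 1 F G; have h2 := sum_mul_eval_mul_add μ' y 1 F G
      simp only [one_mul] at h1 h2; rw [h1, h2]; ring)
    (fun c F => by
      have h1 := sum_mul_eval_mul_smul μ x 1 F c; have h2 := sum_mul_eval_mul_smul μ' y 1 F c
      simp only [one_mul] at h1 h2; rw [h1, h2]; ring)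
    (fun d hd => (recurrence_monic_natDegree hq0 hq1 hrec d).1) (fun d hd => (recurrence_monic_natDegree hq0 hq1 hrec d).2) (fun d hd => ?_) hR
  · simpa [sub_eq_zero] using h
  · have hq0' : q' 0 = 1 := (hshare 0 (Nat.zero_le _)).trans hq0
    have h1 := hpair ⟨d, by omega⟩ ⟨0, by omega⟩
    have h2 := hpair' ⟨d, by omega⟩ ⟨0, by omega⟩
    rw [hq0] at h1
    rw [hshare d hd, hq0'] at h2
    simp only [eval_one, mul_one] at h1 h2
    rw [h1, h2]
    by_cases hd0 : d = 0
    · subst hd0; simp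
    · rw [if_neg (fun h' => hd0 (by have := Fin.mk.inj_iff.1 h'; omega)), if_neg (fun h' => hd0 (by have := Fin.mk.inj_iff.1 h'; omega)), sub_self]

/-- **A FAVARD RULE SEES ONLY THE LEADING BLOCK: `q'_k = q_k` for `k ≤ n + 1` ⇒ `Σ μ f(x) = Σ μ' f(y)` for every `f` of degree `≤ 2n + 1`** (Favard pairings of `q` at level `T ≥ n` and of
`q'` at level `T' ≥ n`). [Gautschi Thm 1.45; Laurie 1996 §2; this file, §1134] -/
theorem favard_prefix_exact {q q' : ℕ → ℝ[X]} {a a' b b' : ℕ → ℝ} (hq0 : q 0 = 1) (hq1 : q 1 = Polynomial.X - C (a 0))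
    (hrec : ∀ n, q (n + 2) = (Polynomial.X - C (a (n + 1))) * q (n + 1) - C (b (n + 1)) * q n)
    (hq0' : q' 0 = 1) (hq1' : q' 1 = Polynomial.X - C (a' 0)) (hrec' : ∀ n, q' (n + 2) = (Polynomial.X - C (a' (n + 1))) * q' (n + 1) - C (b' (n + 1)) * q' n)
    {T T' n : ℕ} (hn : n ≤ T) (hn' : n ≤ T') (hshare : ∀ k, k ≤ n + 1 → q' k = q k)
    {μ x : Fin (T + 1) → ℝ} {μ' y : Fin (T' + 1) → ℝ} (hxr : ∀ k, (q (T + 1)).eval (x k) = 0) (hyr : ∀ k, (q' (T' + 1)).eval (y k) = 0)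
    (hpair : ∀ i j : Fin (T + 1), ∑ k, μ k * ((q i).eval (x k) * (q j).eval (x k)) = if i = j then ∏ l ∈ Finset.Ico 1 ((j : ℕ) + 1), b l else 0)
    (hpair' : ∀ i j : Fin (T' + 1), ∑ k, μ' k * ((q' i).eval (y k) * (q' j).eval (y k)) = if i = j then ∏ l ∈ Finset.Ico 1 ((j : ℕ) + 1), b' l else 0)
    {f : ℝ[X]} (hf : f.natDegree ≤ 2 * n + 1) : ∑ k, μ k * f.eval (x k) = ∑ k, μ' k * f.eval (y k) := by
  obtain ⟨hm, hd⟩ := recurrence_monic_natDegree hq0 hq1 hrec (n + 1)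
  obtain ⟨G, hG⟩ : ∃ G : ℝ[X], G = f /ₘ q (n + 1) := ⟨_, rfl⟩
  obtain ⟨R, hR⟩ : ∃ R : ℝ[X], R = f %ₘ q (n + 1) := ⟨_, rfl⟩
  have hfGR : f = q (n + 1) * G + R := by rw [hG, hR, add_comm, modByMonic_add_div f (q (n + 1))]
  have hRd : R.natDegree ≤ n := by
    have hne : q (n + 1) ≠ 1 := fun h => by have := congrArg natDegree h; rw [hd, natDegree_one] at this; omega
    have := natDegree_modByMonic_lt f hm hne
    rw [hd] at this; rw [hR]; omega
  have hGd : G.natDegree ≤ n := by rw [hG, natDegree_divByMonic f hm, hd]; omega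
  have h1 := favard_rule_orthogonal_succ hq0 hq1 hrec hn hxr hpair hGd
  have h1' := favard_rule_orthogonal_succ hq0' hq1' hrec' hn' hyr hpair' hGd
  rw [hshare (n + 1) le_rfl] at h1'
  have h2 := favard_rule_low_agree hq0 hq1 hrec hn hn' (fun k hk => hshare k (by omega)) hpair hpair' hRd
  have e1 : ∑ k, μ k * f.eval (x k) = ∑ k, μ k * (q (n + 1) * G).eval (x k) + ∑ k, μ k * R.eval (x k) := by
    rw [← Finset.sum_add_distrib]; exact Finset.sum_congr rfl fun k _ => by rw [hfGR, eval_add]; ring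
  have e2 : ∑ k, μ' k * f.eval (y k) = ∑ k, μ' k * (q (n + 1) * G).eval (y k) + ∑ k, μ' k * R.eval (y k) := by
    rw [← Finset.sum_add_distrib]; exact Finset.sum_congr rfl fun k _ => by rw [hfGR, eval_add]; ring
  rw [e1, e2, h1, h1', h2]

end Summit.Ventures.HSemireg.Wedge.HankelOuter
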